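import Mathlib

/-!
# Chessboard estimate from the mixed reflection step on the odd cycle
(stub `stub_chessboardOfReflection` of line `Sketch`, crux `QuarksAsStableAction.WilsonQuarkStability`,
item stmt-QuantumFields-9736; lead prover-line-stmt-QuantumFields-9736-c2-0)

Abstract Fröhlich–Israel–Lieb–Simon maximiser argument on the cycle `ℤ/(2n+1)`: a non-negative functional `F` of
alternating words `(c, v)` (positive letters `c j : α`, unitary letters `v j : β`) that is rotation invariant,
satisfies the Cauchy–Schwarz bound of the MIXED site/link reflection of the odd cycle
(`F(c,v)² ≤ F(c⁺,v⁺) · F(c⁻,v⁻)`), and takes the value `ν a > 0` on the homogeneous word `(a,…,a; e,…,e)`,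
obeys the chessboard bound `F(c,v)^{2n+1} ≤ ∏_j ν (c j)`.

Proof: `Φ(w) := F(w)^{2n+1} / ∏_j ν(c j)` is rotation invariant and satisfies `Φ(w)² ≤ Φ(w⁺) Φ(w⁻)` (the two
doubles use every letter of `w` exactly twice), so a maximiser of `Φ` over the finite word space stays a
maximiser under `w ↦ w⁺`; reflecting through the unitary letter just after a homogeneous block doubles the block,
so `O(log n)` reflections produce a homogeneous maximiser, where `Φ = 1`.
References: J. Fröhlich, R. Israel, E. H. Lieb, B. Simon, Commun. Math. Phys. 62 (1978) 1, Thm. 4.1;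
M. Biskup, *Reflection positivity and phase transitions in lattice spin models*, §5 (arXiv:math-ph/0610025).
Pure theorem file (no definitions).
-/

namespace Summit.QuantumFields.QCD.Cruxes.WilsonQuarkStability.FreeTangentLandauChessboard

namespace ChessboardOfReflection

open Finset

/-! ### Arithmetic in `ZMod N` at natural-number positions -/

/-- `-(q : ZMod N) = N - q` for `q ≤ N`. -/
theorem neg_natCast_eq {N q : ℕ} (hq : q ≤ N) : -((q : ℕ) : ZMod N) = ((N - q : ℕ) : ZMod N) := by
  rw [Nat.cast_sub hq, ZMod.natCast_self, zero_sub]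

/-- `-1 - (q : ZMod N) = N - 1 - q` for `q + 1 ≤ N`. -/
theorem neg_one_sub_natCast_eq {N q : ℕ} (hq : q + 1 ≤ N) :
    -1 - ((q : ℕ) : ZMod N) = ((N - 1 - q : ℕ) : ZMod N) := by
  rw [Nat.sub_sub, Nat.cast_sub (by omega), ZMod.natCast_self, zero_sub, Nat.cast_add, Nat.cast_one,
    neg_add']

/-- A product over `ZMod N` is a product over the natural positions `q < N`. -/
theorem prod_univ_eq_prod_range {N : ℕ} [NeZero N] (f : ZMod N → ℝ) :
    ∏ j, f j = ∏ q ∈ range N, f q := by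
  refine Finset.prod_nbij' (fun j => j.val) (fun q => (q : ZMod N)) (fun j _ => ?_) (fun q hq => ?_)
    (fun j _ => ?_) (fun q hq => ?_) (fun j _ => ?_)
  · exact mem_range.2 (ZMod.val_lt j)
  · exact mem_univ _
  · exact ZMod.natCast_zmod_val j
  · exact ZMod.val_cast_of_lt (mem_range.1 hq)
  · rw [ZMod.natCast_zmod_val]

/-! ### The reflected words at natural positions -/

variable {α β : Type}

/-- The positive-letter word of the `P Pᴴ` double at position `q < 2n+1`. -/
theorem cPlus_natCast (n : ℕ) (c : ZMod (2 * n + 1) → α) {q : ℕ} (hq : q < 2 * n + 1) :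
    (if ((q : ℕ) : ZMod (2 * n + 1)).val ≤ n then c q else c (-((q : ℕ) : ZMod (2 * n + 1)))) =
      if q ≤ n then c q else c ((2 * n + 1 - q : ℕ) : ZMod (2 * n + 1)) := by
  simp only [ZMod.val_cast_of_lt hq, neg_natCast_eq hq.le]

/-- The unitary-letter word of the `P Pᴴ` double at position `q < 2n+1`. -/
theorem vPlus_natCast (n : ℕ) (v : ZMod (2 * n + 1) → β) (e : β) (ι : β → β) {q : ℕ}
    (hq : q < 2 * n + 1) :
    (if ((q : ℕ) : ZMod (2 * n + 1)).val < n then v q else if ((q : ℕ) : ZMod (2 * n + 1)).val = n then e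
        else ι (v (-1 - ((q : ℕ) : ZMod (2 * n + 1))))) =
      if q < n then v q else if q = n then e else ι (v ((2 * n - q : ℕ) : ZMod (2 * n + 1))) := by
  simp only [ZMod.val_cast_of_lt hq, neg_one_sub_natCast_eq (Nat.succ_le_of_lt hq)]
  rfl

/-- The positive-letter word of the `Qᴴ Q` double at position `q < 2n+1`. -/
theorem cMinus_natCast (n : ℕ) (c : ZMod (2 * n + 1) → α) {q : ℕ} (hq : q < 2 * n + 1) :
    (if 0 < ((q : ℕ) : ZMod (2 * n + 1)).val ∧ ((q : ℕ) : ZMod (2 * n + 1)).val ≤ n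
        then c (-((q : ℕ) : ZMod (2 * n + 1))) else c q) =
      if 0 < q ∧ q ≤ n then c ((2 * n + 1 - q : ℕ) : ZMod (2 * n + 1)) else c q := by
  simp only [ZMod.val_cast_of_lt hq, neg_natCast_eq hq.le]

/-! ### The two doubles use every positive letter exactly twice -/

/-- Reindexing by `j ↦ -j`: the positions `n < j.val` of `ZMod (2n+1)` go to the positions `0 < i.val ≤ n`. -/
theorem prod_filter_not_le_neg (n : ℕ) (g : ZMod (2 * n + 1) → ℝ) :
    ∏ j ∈ univ.filter (fun j : ZMod (2 * n + 1) => ¬ j.val ≤ n), g (-j) =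
      ∏ i ∈ univ.filter (fun i : ZMod (2 * n + 1) => 0 < i.val ∧ i.val ≤ n), g i := by
  refine Finset.prod_nbij' (fun j => -j) (fun i => -i) (fun j hj => ?_) (fun i hi => ?_)
    (fun j _ => neg_neg j) (fun i _ => neg_neg i) (fun j _ => rfl)
  · simp only [mem_filter, mem_univ, true_and] at hj ⊢
    have hj0 : j ≠ 0 := by rintro rfl; simp at hj
    rw [ZMod.neg_val, if_neg hj0]
    have := ZMod.val_lt j
    omega
  · simp only [mem_filter, mem_univ, true_and] at hi ⊢
    have hi0 : i ≠ 0 := by rintro rfl; simp at hi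
    rw [ZMod.neg_val, if_neg hi0]
    omega

/-- Reindexing by `i ↦ -i`: the positions `0 < i.val ≤ n` of `ZMod (2n+1)` go to the positions `n < j.val`. -/
theorem prod_filter_pos_le_neg (n : ℕ) (g : ZMod (2 * n + 1) → ℝ) :
    ∏ i ∈ univ.filter (fun i : ZMod (2 * n + 1) => 0 < i.val ∧ i.val ≤ n), g (-i) =
      ∏ j ∈ univ.filter (fun j : ZMod (2 * n + 1) => ¬ j.val ≤ n), g j := by
  rw [← prod_filter_not_le_neg n (fun j => g (-j))]
  simp only [neg_neg]

/-- `∏_j ν(c⁺ j) · ∏_j ν(c⁻ j) = (∏_j ν(c j))²`: the two doubles use every positive letter exactly twice. -/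
theorem prod_cPlus_mul_prod_cMinus (n : ℕ) (ν : α → ℝ) (c : ZMod (2 * n + 1) → α) :
    (∏ j, ν ((fun j : ZMod (2 * n + 1) => if j.val ≤ n then c j else c (-j)) j)) *
        (∏ j, ν ((fun j : ZMod (2 * n + 1) => if 0 < j.val ∧ j.val ≤ n then c (-j) else c j) j)) =
      (∏ j, ν (c j)) ^ 2 := by
  have hP : (∏ j, ν ((fun j : ZMod (2 * n + 1) => if j.val ≤ n then c j else c (-j)) j)) =
      (∏ j ∈ univ.filter (fun j : ZMod (2 * n + 1) => j.val ≤ n), ν (c j)) *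
        ∏ j ∈ univ.filter (fun j : ZMod (2 * n + 1) => 0 < j.val ∧ j.val ≤ n), ν (c j) := by
    rw [← prod_filter_not_le_neg n (fun j => ν (c j)), ← prod_ite]
    refine prod_congr rfl fun j _ => ?_
    beta_reduce
    split_ifs <;> rfl
  have hM : (∏ j, ν ((fun j : ZMod (2 * n + 1) => if 0 < j.val ∧ j.val ≤ n then c (-j) else c j) j)) =
      (∏ j ∈ univ.filter (fun j : ZMod (2 * n + 1) => ¬ j.val ≤ n), ν (c j)) *
        ∏ j ∈ univ.filter (fun j : ZMod (2 * n + 1) => ¬ (0 < j.val ∧ j.val ≤ n)), ν (c j) := by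
    rw [← prod_filter_pos_le_neg n (fun j => ν (c j)), ← prod_ite]
    refine prod_congr rfl fun j _ => ?_
    beta_reduce
    split_ifs <;> rfl
  rw [hP, hM, ← prod_filter_mul_prod_filter_not univ (fun j : ZMod (2 * n + 1) => j.val ≤ n) (fun j => ν (c j))]
  have h2 := prod_filter_mul_prod_filter_not univ (fun j : ZMod (2 * n + 1) => 0 < j.val ∧ j.val ≤ n)
    (fun j => ν (c j))
  rw [← prod_filter_mul_prod_filter_not univ (fun j : ZMod (2 * n + 1) => j.val ≤ n) (fun j => ν (c j))] at h2
  rw [sq]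
  nth_rewrite 2 [← h2]
  ring


/-! ### Reflecting through the unitary letter after a homogeneous block doubles the block -/

/-- **Block doubling.** If the positive letters at the natural positions `n+1-k ≤ q ≤ n` all equal `a` and the
unitary letters strictly inside that block all equal `e` (`1 ≤ k ≤ n`), then in the `P Pᴴ` double the positive
letters at `n+1-k ≤ q ≤ n+k` all equal `a` and the unitary letters strictly inside all equal `e`. -/
theorem block_double (n : ℕ) (c : ZMod (2 * n + 1) → α) (v : ZMod (2 * n + 1) → β) (e : β) (ι : β → β)
    (hιe : ι e = e) (a : α) {k : ℕ} (hkn : k ≤ n)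
    (hc : ∀ q : ℕ, n + 1 ≤ q + k → q ≤ n → c q = a)
    (hv : ∀ q : ℕ, n + 1 ≤ q + k → q + 1 ≤ n → v q = e) :
    (∀ q : ℕ, n + 1 ≤ q + k → q ≤ n + k →
        (fun j : ZMod (2 * n + 1) => if j.val ≤ n then c j else c (-j)) q = a) ∧
      (∀ q : ℕ, n + 1 ≤ q + k → q + 1 ≤ n + k →
        (fun j : ZMod (2 * n + 1) => if j.val < n then v j else if j.val = n then e else ι (v (-1 - j))) q = e) := by
  refine ⟨fun q hq1 hq2 => ?_, fun q hq1 hq2 => ?_⟩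
  · beta_reduce
    rw [cPlus_natCast n c (by omega)]
    split_ifs with h
    · exact hc q hq1 h
    · exact hc (2 * n + 1 - q) (by omega) (by omega)
  · beta_reduce
    rw [vPlus_natCast n v e ι (by omega)]
    split_ifs with h1 h2
    · exact hv q hq1 (by omega)
    · rfl
    · rw [hv (2 * n - q) (by omega) (by omega), hιe]

/-- **Saturation.** If the positive letters at `0 ≤ q ≤ n` all equal `a` and the unitary letters at `0 ≤ q < n`
all equal `e`, then the `P Pᴴ` double is the homogeneous word `(a, …, a; e, …, e)`. -/
theorem block_saturate (n : ℕ) (c : ZMod (2 * n + 1) → α) (v : ZMod (2 * n + 1) → β) (e : β) (ι : β → β)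
    (hιe : ι e = e) (a : α)
    (hc : ∀ q : ℕ, q ≤ n → c q = a) (hv : ∀ q : ℕ, q + 1 ≤ n → v q = e) :
    ((fun j : ZMod (2 * n + 1) => if j.val ≤ n then c j else c (-j)) = fun _ => a) ∧
      ((fun j : ZMod (2 * n + 1) => if j.val < n then v j else if j.val = n then e else ι (v (-1 - j))) =
        fun _ => e) := by
  refine ⟨funext fun j => ?_, funext fun j => ?_⟩
  · have hj : j = ((j.val : ℕ) : ZMod (2 * n + 1)) := (ZMod.natCast_zmod_val j).symm
    have hlt := ZMod.val_lt j
    rw [hj, cPlus_natCast n c hlt]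
    split_ifs with h
    · exact hc _ h
    · exact hc _ (by omega)
  · have hj : j = ((j.val : ℕ) : ZMod (2 * n + 1)) := (ZMod.natCast_zmod_val j).symm
    have hlt := ZMod.val_lt j
    rw [hj, vPlus_natCast n v e ι hlt]
    split_ifs with h1 h2
    · exact hv _ (by omega)
    · rfl
    · rw [hv _ (by omega), hιe]

/-- Shifting a word: a block at natural positions `s ≤ q < s + k` of `(c, v)` is a block at `0 ≤ q < k` of the
word shifted by `s`. -/
theorem block_shift_to_zero (n : ℕ) (c : ZMod (2 * n + 1) → α) (v : ZMod (2 * n + 1) → β) (e : β) (a : α)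
    (s k : ℕ) (hc : ∀ q : ℕ, s ≤ q → q < s + k → c q = a) (hv : ∀ q : ℕ, s ≤ q → q + 1 < s + k → v q = e) :
    (∀ q : ℕ, q < k → (fun j : ZMod (2 * n + 1) => c (j + s)) q = a) ∧
      (∀ q : ℕ, q + 1 < k → (fun j : ZMod (2 * n + 1) => v (j + s)) q = e) := by
  refine ⟨fun q hq => ?_, fun q hq => ?_⟩
  · show c (q + s) = a
    rw [← Nat.cast_add]
    exact hc (q + s) (by omega) (by omega)
  · show v (q + s) = e
    rw [← Nat.cast_add]
    exact hv (q + s) (by omega) (by omega)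

/-- Shifting a word: a block at natural positions `0 ≤ q < k` of `(c, v)` (`k ≤ n + 1`) is a block at
`n+1-k ≤ q ≤ n` of the word shifted by `-(n+1-k)`. -/
theorem block_shift_to_end (n : ℕ) (c : ZMod (2 * n + 1) → α) (v : ZMod (2 * n + 1) → β) (e : β) (a : α)
    (k : ℕ) (hc : ∀ q : ℕ, q < k → c q = a) (hv : ∀ q : ℕ, q + 1 < k → v q = e) :
    (∀ q : ℕ, n + 1 ≤ q + k → q ≤ n →
        (fun j : ZMod (2 * n + 1) => c (j + -((n + 1 - k : ℕ) : ZMod (2 * n + 1)))) q = a) ∧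
      (∀ q : ℕ, n + 1 ≤ q + k → q + 1 ≤ n →
        (fun j : ZMod (2 * n + 1) => v (j + -((n + 1 - k : ℕ) : ZMod (2 * n + 1)))) q = e) := by
  refine ⟨fun q hq1 hq2 => ?_, fun q hq1 hq2 => ?_⟩
  · show c (q + -((n + 1 - k : ℕ) : ZMod (2 * n + 1))) = a
    rw [← sub_eq_add_neg, ← Nat.cast_sub (by omega)]
    exact hc _ (by omega)
  · show v (q + -((n + 1 - k : ℕ) : ZMod (2 * n + 1))) = e
    rw [← sub_eq_add_neg, ← Nat.cast_sub (by omega)]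
    exact hv _ (by omega)


/-! ### The maximiser argument -/

/-- Rotation invariance under every natural shift, from invariance under the unit shift. -/
theorem shift_invariant_nat (n : ℕ) (Φ : (ZMod (2 * n + 1) → α) × (ZMod (2 * n + 1) → β) → ℝ)
    (hrot : ∀ c v, Φ ((fun j => c (j + 1)), (fun j => v (j + 1))) = Φ (c, v))
    (c : ZMod (2 * n + 1) → α) (v : ZMod (2 * n + 1) → β) (t : ℕ) :
    Φ ((fun j => c (j + t)), (fun j => v (j + t))) = Φ (c, v) := by
  induction t with
  | zero => simp
  | succ t ih =>
    have h := hrot (fun j => c (j + t)) (fun j => v (j + t))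
    have hc : (fun j : ZMod (2 * n + 1) => c (j + ((t + 1 : ℕ) : ZMod (2 * n + 1)))) =
        fun j => c (j + 1 + t) := funext fun j => congrArg c (by push_cast; ring)
    have hv : (fun j : ZMod (2 * n + 1) => v (j + ((t + 1 : ℕ) : ZMod (2 * n + 1)))) =
        fun j => v (j + 1 + t) := funext fun j => congrArg v (by push_cast; ring)
    rw [hc, hv, h, ih]

/-- **A homogeneous word dominates.** For a non-negative functional on the finite word space that is rotation
invariant and satisfies the mixed reflection step, every word is dominated by some homogeneous word
`(a, …, a; e, …, e)` (Fröhlich–Israel–Lieb–Simon: a maximiser stays a maximiser under `w ↦ w⁺`, and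
`O(log n)` block doublings saturate it). -/
theorem exists_hom_ge [Fintype α] [Fintype β] [DecidableEq α] [DecidableEq β] (n : ℕ)
    (Φ : (ZMod (2 * n + 1) → α) × (ZMod (2 * n + 1) → β) → ℝ) (hΦ : ∀ w, 0 ≤ Φ w)
    (e : β) (ι : β → β) (hιe : ι e = e)
    (hrot : ∀ c v, Φ ((fun j => c (j + 1)), (fun j => v (j + 1))) = Φ (c, v))
    (hrefl : ∀ c v, Φ (c, v) ^ 2 ≤
      Φ ((fun j => if j.val ≤ n then c j else c (-j)),
          (fun j => if j.val < n then v j else if j.val = n then e else ι (v (-1 - j)))) *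
        Φ ((fun j => if 0 < j.val ∧ j.val ≤ n then c (-j) else c j),
          (fun j => if j.val < n then ι (v (-1 - j)) else if j.val = n then e else v j)))
    (c : ZMod (2 * n + 1) → α) (v : ZMod (2 * n + 1) → β) :
    ∃ a, Φ (c, v) ≤ Φ ((fun _ => a), (fun _ => e)) := by
  classical
  obtain ⟨w₀, -, hw₀⟩ := Finset.exists_max_image Finset.univ Φ ⟨(c, v), Finset.mem_univ _⟩
  set M := Φ w₀ with hM_def
  have hle : ∀ w, Φ w ≤ M := fun w => hw₀ w (Finset.mem_univ _)
  by_cases hM0 : M = 0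
  · exact ⟨c 0, (hle _).trans (hM0.le.trans (hΦ _))⟩
  have hMpos : 0 < M := lt_of_le_of_ne (hΦ _) (Ne.symm hM0)
  -- maximality is preserved by the `P Pᴴ` double
  have hreflMax : ∀ (c' : ZMod (2 * n + 1) → α) (v' : ZMod (2 * n + 1) → β), Φ (c', v') = M →
      Φ ((fun j => if j.val ≤ n then c' j else c' (-j)),
          (fun j => if j.val < n then v' j else if j.val = n then e else ι (v' (-1 - j)))) = M := by
    intro c' v' h
    refine le_antisymm (hle _) ?_
    have h1 := hrefl c' v'
    rw [h, pow_two] at h1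
    exact le_of_mul_le_mul_right (h1.trans (mul_le_mul_of_nonneg_left (hle _) (hΦ _))) hMpos
  -- maximality is preserved by shifts
  have hshiftMax : ∀ (c' : ZMod (2 * n + 1) → α) (v' : ZMod (2 * n + 1) → β) (t : ZMod (2 * n + 1)),
      Φ (c', v') = M → Φ ((fun j => c' (j + t)), (fun j => v' (j + t))) = M := by
    intro c' v' t h
    rw [← h, ← ZMod.natCast_zmod_val t]
    exact shift_invariant_nat n Φ hrot c' v' t.val
  -- the doubling chain: maximisers with a homogeneous block of size `min (2^r) (n+1)` at `0 ≤ q < k`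
  have key : ∀ r : ℕ, ∃ (c' : ZMod (2 * n + 1) → α) (v' : ZMod (2 * n + 1) → β) (a : α),
      Φ (c', v') = M ∧ (∀ q : ℕ, q < min (2 ^ r) (n + 1) → c' q = a) ∧
        (∀ q : ℕ, q + 1 < min (2 ^ r) (n + 1) → v' q = e) := by
    intro r
    induction r with
    | zero =>
      have h1 : min (2 ^ 0) (n + 1) = 1 := by rw [pow_zero]; exact min_eq_left (by omega)
      refine ⟨w₀.1, w₀.2, w₀.1 ((0 : ℕ) : ZMod (2 * n + 1)), hM_def.symm, fun q hq => ?_, fun q hq => ?_⟩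
      · rw [h1] at hq
        obtain rfl : q = 0 := by omega
        rfl
      · rw [h1] at hq
        omega
    | succ r ih =>
      obtain ⟨c', v', a, hmax, hc', hv'⟩ := ih
      by_cases hr : n + 1 ≤ 2 ^ r
      · -- the block is already saturated: same witness
        have hk : min (2 ^ r) (n + 1) = n + 1 := min_eq_right hr
        have hk' : min (2 ^ (r + 1)) (n + 1) = n + 1 :=
          min_eq_right (hr.trans (Nat.pow_le_pow_right (by norm_num) (Nat.le_succ r)))
        refine ⟨c', v', a, hmax, fun q hq => hc' q ?_, fun q hq => hv' q ?_⟩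
        · rw [hk]; rw [hk'] at hq; exact hq
        · rw [hk]; rw [hk'] at hq; exact hq
      · -- `k = 2^r ≤ n`: shift the block to the end of the first half, reflect, shift back
        have hr' : 2 ^ r < n + 1 := Nat.lt_of_not_le hr
        have hk : min (2 ^ r) (n + 1) = 2 ^ r := min_eq_left hr'.le
        rw [hk] at hc' hv'
        have hkn : 2 ^ r ≤ n := Nat.lt_succ_iff.mp hr'
        -- shift so that the block ends at position `n`
        set c₁ : ZMod (2 * n + 1) → α := fun j => c' (j + -((n + 1 - 2 ^ r : ℕ) : ZMod (2 * n + 1))) with hc₁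
        set v₁ : ZMod (2 * n + 1) → β := fun j => v' (j + -((n + 1 - 2 ^ r : ℕ) : ZMod (2 * n + 1))) with hv₁
        obtain ⟨hc1, hv1⟩ := block_shift_to_end n c' v' e a (2 ^ r) hc' hv'
        rw [← hc₁] at hc1
        rw [← hv₁] at hv1
        have hmax1 : Φ (c₁, v₁) = M := hshiftMax c' v' (-((n + 1 - 2 ^ r : ℕ) : ZMod (2 * n + 1))) hmax
        -- reflect: the block doubles
        set c₂ : ZMod (2 * n + 1) → α := fun j => if j.val ≤ n then c₁ j else c₁ (-j) with hc₂
        set v₂ : ZMod (2 * n + 1) → β :=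
          fun j => if j.val < n then v₁ j else if j.val = n then e else ι (v₁ (-1 - j)) with hv₂
        obtain ⟨hc2, hv2⟩ := block_double n c₁ v₁ e ι hιe a hkn hc1 hv1
        rw [← hc₂] at hc2
        rw [← hv₂] at hv2
        have hmax2 : Φ (c₂, v₂) = M := hreflMax c₁ v₁ hmax1
        -- shift the doubled block back to position `0`
        set c₃ : ZMod (2 * n + 1) → α := fun j => c₂ (j + ((n + 1 - 2 ^ r : ℕ) : ZMod (2 * n + 1))) with hc₃
        set v₃ : ZMod (2 * n + 1) → β := fun j => v₂ (j + ((n + 1 - 2 ^ r : ℕ) : ZMod (2 * n + 1))) with hv₃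
        obtain ⟨hc3, hv3⟩ := block_shift_to_zero n c₂ v₂ e a (n + 1 - 2 ^ r) (2 * 2 ^ r)
          (fun q h1 h2 => hc2 q (by omega) (by omega)) (fun q h1 h2 => hv2 q (by omega) (by omega))
        rw [← hc₃] at hc3
        rw [← hv₃] at hv3
        have hmax3 : Φ (c₃, v₃) = M := hshiftMax c₂ v₂ ((n + 1 - 2 ^ r : ℕ) : ZMod (2 * n + 1)) hmax2
        refine ⟨c₃, v₃, a, hmax3, fun q hq => hc3 q ?_, fun q hq => hv3 q ?_⟩
        · have := lt_of_lt_of_le hq (min_le_left _ _)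
          rw [pow_succ] at this
          omega
        · have := lt_of_lt_of_le hq (min_le_left _ _)
          rw [pow_succ] at this
          omega
  -- saturate
  obtain ⟨c', v', a, hmax, hc', hv'⟩ := key (n + 1)
  have hmin : min (2 ^ (n + 1)) (n + 1) = n + 1 := min_eq_right (Nat.lt_two_pow_self).le
  rw [hmin] at hc' hv'
  obtain ⟨hc2, hv2⟩ := block_saturate n c' v' e ι hιe a (fun q hq => hc' q (by omega))
    (fun q hq => hv' q (by omega))
  have hmax2 := hreflMax c' v' hmax
  rw [hc2, hv2] at hmax2
  exact ⟨a, (hle _).trans hmax2.symm.le⟩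

end ChessboardOfReflection

open ChessboardOfReflection in
/-- **Stub `stub_chessboardOfReflection`** (line `Sketch`, crux stmt-QuantumFields-9736): the chessboard estimate
on the odd cycle `ℤ/(2n+1)` from rotation invariance, the mixed reflection step and the homogeneous values — see
the module docstring. -/
theorem stub_chessboardOfReflection {α β : Type} [Fintype α] [Fintype β] [DecidableEq α] [DecidableEq β]
    (n : ℕ) (F : (ZMod (2 * n + 1) → α) → (ZMod (2 * n + 1) → β) → ℝ) (hF : ∀ c v, 0 ≤ F c v)
    (ν : α → ℝ) (hν : ∀ a, 0 < ν a) (e : β) (ι : β → β) (hιe : ι e = e)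
    (hrot : ∀ c v, F (fun j => c (j + 1)) (fun j => v (j + 1)) = F c v)
    (hrefl : ∀ c v, F c v ^ 2 ≤
      F (fun j => if j.val ≤ n then c j else c (-j))
          (fun j => if j.val < n then v j else if j.val = n then e else ι (v (-1 - j))) *
        F (fun j => if 0 < j.val ∧ j.val ≤ n then c (-j) else c j)
          (fun j => if j.val < n then ι (v (-1 - j)) else if j.val = n then e else v j))
    (hhom : ∀ a, F (fun _ => a) (fun _ => e) = ν a)
    (c : ZMod (2 * n + 1) → α) (v : ZMod (2 * n + 1) → β) :
    F c v ^ (2 * n + 1) ≤ ∏ j, ν (c j) := by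
  have hνprod : ∀ c' : ZMod (2 * n + 1) → α, 0 < ∏ j, ν (c' j) :=
    fun c' => Finset.prod_pos fun j _ => hν _
  -- the normalised functional `Φ(w) = F(w)^{2n+1} / ∏_j ν(c j)`
  set Φ : (ZMod (2 * n + 1) → α) × (ZMod (2 * n + 1) → β) → ℝ :=
    fun w => F w.1 w.2 ^ (2 * n + 1) / ∏ j, ν (w.1 j) with hΦ_def
  have hΦnn : ∀ w, 0 ≤ Φ w := fun w => div_nonneg (pow_nonneg (hF _ _) _) (hνprod _).le
  have hΦrot : ∀ (c' : ZMod (2 * n + 1) → α) (v' : ZMod (2 * n + 1) → β),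
      Φ ((fun j => c' (j + 1)), (fun j => v' (j + 1))) = Φ (c', v') := by
    intro c' v'
    simp only [hΦ_def]
    rw [hrot c' v', Fintype.prod_equiv (Equiv.addRight 1) (fun j => ν (c' (j + 1))) (fun j => ν (c' j))
      (fun j => rfl)]
  have hΦrefl : ∀ (c' : ZMod (2 * n + 1) → α) (v' : ZMod (2 * n + 1) → β), Φ (c', v') ^ 2 ≤
      Φ ((fun j => if j.val ≤ n then c' j else c' (-j)),
          (fun j => if j.val < n then v' j else if j.val = n then e else ι (v' (-1 - j)))) *
        Φ ((fun j => if 0 < j.val ∧ j.val ≤ n then c' (-j) else c' j),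
          (fun j => if j.val < n then ι (v' (-1 - j)) else if j.val = n then e else v' j)) := by
    intro c' v'
    simp only [hΦ_def]
    rw [div_pow, div_mul_div_comm, prod_cPlus_mul_prod_cMinus n ν c', ← mul_pow]
    refine div_le_div_of_nonneg_right ?_ (sq_nonneg _)
    calc (F c' v' ^ (2 * n + 1)) ^ 2 = (F c' v' ^ 2) ^ (2 * n + 1) := by ring
      _ ≤ _ := pow_le_pow_left₀ (sq_nonneg _) (hrefl c' v') (2 * n + 1)
  obtain ⟨a, ha⟩ := exists_hom_ge n Φ hΦnn e ι hιe hΦrot hΦrefl c v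
  have hhomΦ : Φ ((fun _ => a), (fun _ => e)) = 1 := by
    simp only [hΦ_def]
    rw [hhom a, Finset.prod_const, Finset.card_univ, ZMod.card, div_self (pow_ne_zero _ (hν a).ne')]
  rw [hhomΦ] at ha
  have ha' : F c v ^ (2 * n + 1) / ∏ j, ν (c j) ≤ 1 := ha
  rwa [div_le_one (hνprod c)] at ha'

end Summit.QuantumFields.QCD.Cruxes.WilsonQuarkStability.FreeTangentLandauChessboard
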